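import Summits.SmoothPoincare4.SmoothPoincare4.Theses.InformationMetricHadamard
import Summits.SmoothPoincare4.SmoothPoincare4.Theorems.InformationMetricHadamardC0AhRecognitionStubFlowToRoundSphereAux1
import Summits.SmoothPoincare4.SmoothPoincare4.Theorems.InformationMetricHadamardC0AhRecognitionStubFlowToRoundSphereAux2
import Summits.SmoothPoincare4.SmoothPoincare4.Theorems.InformationMetricHadamardC0AhRecognitionStubFlowToRoundSphereAux3
import Summits.SmoothPoincare4.SmoothPoincare4.Theorems.InformationMetricHadamardConvexEndRecognitionSphere
import Literature.Topology.FourManifolds.WhitneyModelSheets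
import Mathlib.Geometry.Manifold.Instances.Sphere

/-!
# Line `core-distance-morse`, crux `InformationMetricHadamard.C0AhRecognition` (stmt-SmoothPoincare4-6015) — stub `stub_flowToRoundSphere`

**Stub E3: the flow carries a compact level onto a round sphere.** Let `(W⁵, G)` be a complete
Riemannian manifold (closed distance balls compact), `K ⊆ W` compact nonempty, `a > 0`,
`f = d_G(·, K)`, and `X, δ, o, R₀, e` as produced by stub E1: `X` smooth with `G(X, X) ≤ 1`, `f`
grows at rate `≥ δ` along integral curves of `X` started in `{f ≥ a}`, `e : ℝ⁵ ≅ W` polar at `o`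
(`d_G(o, e v) = |v|ₒ := √(G_o(v, v))`) with `X (e v) = de_v (v/|v|ₒ)` for `|v|ₒ ≥ R₀`. If a closed
`4`-manifold `N` is injectively immersed by `j` onto `{f = a}`, then `N ≅ S⁴`.

Proof (no hitting times needed):
1. `X` is complete with a smooth global flow `θ` (`helper_flowToRoundSphere_1`), `d_G(p, θ_t p) ≤ |t|`,
   `θ_t` and `dθ_t` injective, `dθ_t X = X ∘ θ_t`.
2. Along `t ↦ θ_t (j n)`, `f ≥ a + δ t`; since `f ≤ d_G(o, ·) + D` (`D = max_K d_G(o, ·)`), the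
   uniform time `T₁ = (R₀ + D + 1)/δ` puts `F n := θ_{T₁} (j n)` in the radial zone
   `{|e⁻¹ ·|ₒ ≥ R₀ + 1}`.
3. The radial projection `La n := e⁻¹(F n)/‖e⁻¹(F n)‖ ∈ S⁴` is smooth; it is injective because two
   points of `F(N)` on a common ray are joined by a flow line (`helper_flowToRoundSphere_2`: flow
   lines in the radial zone are rays), which is impossible between two points of a level of the
   strictly increasing `f`; its differential is injective because its kernel is carried by `dF⁻¹`
   of the radial direction `X ∘ F = dθ_{T₁} (X ∘ j)`, and `X ∘ j` is transverse to the level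
   (`helper_flowToRoundSphere_3`); it is surjective since `N ≠ ∅` (`{f = a} ≠ ∅` by the
   intermediate value theorem on the connected `W ≅ ℝ⁵`) and its image is open and closed in the
   connected `S⁴`. A bijective local diffeomorphism is a diffeomorphism.

Everything is proved (kind = proof); no definitions.
-/

noncomputable section

-- the prescribed namespace `Summit.<P>.<Sub>.…` duplicates `SmoothPoincare4` (P = Sub)
set_option linter.dupNamespace false

open scoped Manifold ContDiff Topology ENNReal NNReal
open Set Function Bundle Filter Manifold Module

namespace Summit.SmoothPoincare4.SmoothPoincare4.Cruxes.C0AhRecognition.CoreDistanceMorse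

open Literature.Topology.FourManifolds (HomotopySphere isLocalDiffeomorphAt_of_mfderiv_injective)
open Literature.Geometry.Lorentzian (PseudoRiemannianMetric)
open Literature.Geometry.Lorentzian.PseudoRiemannianMetric Literature.Geometry.Riemannian
  Literature.Geometry.Riemannian.SimpleAH
  Summit.SmoothPoincare4.SmoothPoincare4.Theorems

set_option maxHeartbeats 800000 in
/-- **Stub E3 (`flowToRoundSphere`).** Let `(W, G)` be a complete Riemannian 5-manifold, `K ⊆ W`
compact and nonempty, `a > 0`, and let `X, δ, o, R₀, e` be as produced by stub E1 (smooth,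
`|X|_G ≤ 1`, `f = d(·,K)` grows at rate `≥ δ` along integral curves started in `{f ≥ a}`,
`e : ℝ⁵ ≅ W` polar at `o`, `X = e_*(v/|v|_{G_o})` for `|v|_{G_o} ≥ R₀`). If a closed 4-manifold `N`
is injectively immersed by `j` onto the level `{f = a}`, then `N ≅ S⁴`. See the module docstring
for the proof (global flow for the uniform time `T₁ = (R₀ + D + 1)/δ` into the radial zone, then
radial projection: a bijective local diffeomorphism onto `S⁴`).
[cite: LeeSmoothManifolds2013, Thm. 9.12] -/
theorem stub_flowToRoundSphere
    (W : Type) [TopologicalSpace W] [T2Space W] [SecondCountableTopology W]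
    [ChartedSpace (EuclideanSpace ℝ (Fin 5)) W] [IsManifold (𝓡 5) ∞ W]
    (G : PseudoRiemannianMetric (𝓡 5) ∞ (EuclideanSpace ℝ (Fin 5)) (TangentSpace (𝓡 5) : W → Type _))
    (hG : G.IsRiemannian)
    (hcpt : ∀ (x : W) (r : NNReal), IsCompact {y : W | G.edist hG x y ≤ r})
    (K : Set W) (hK : IsCompact K) (hKne : K.Nonempty) (a : ℝ) (ha : 0 < a)
    (X : Π y : W, TangentSpace (𝓡 5) y) (δ : ℝ) (o : W) (R₀ : ℝ)
    (e : EuclideanSpace ℝ (Fin 5) ≃ₘ^∞⟮𝓡 5, 𝓡 5⟯ W)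
    (hδ : 0 < δ) (hR₀ : 0 < R₀)
    (hX : ContMDiff (𝓡 5) (𝓡 5).tangent ∞ (fun y ↦ (⟨y, X y⟩ : TangentBundle (𝓡 5) W)))
    (hXle : ∀ y : W, G.val y (X y) (X y) ≤ 1)
    (hlyap : ∀ (γ : ℝ → W) (t₁ t₂ : ℝ), t₁ ≤ t₂ → IsMIntegralCurveOn γ X (Icc t₁ t₂) →
      ENNReal.ofReal a ≤ ⨅ k ∈ K, G.edist hG (γ t₁) k →
      (⨅ k ∈ K, G.edist hG (γ t₁) k) + ENNReal.ofReal (δ * (t₂ - t₁)) ≤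
        ⨅ k ∈ K, G.edist hG (γ t₂) k)
    (he0 : e 0 = o)
    (hedist : ∀ v : EuclideanSpace ℝ (Fin 5),
      G.edist hG o (e v) = ENNReal.ofReal (Real.sqrt (G.val o v v)))
    (hrad : ∀ v : EuclideanSpace ℝ (Fin 5), R₀ ≤ Real.sqrt (G.val o v v) →
      X (e v) = mfderiv (𝓡 5) (𝓡 5) e v ((Real.sqrt (G.val o v v))⁻¹ • v))
    (N : Type) [TopologicalSpace N] [T2Space N] [SecondCountableTopology N] [CompactSpace N]
    [ChartedSpace (EuclideanSpace ℝ (Fin 4)) N] [IsManifold (𝓡 4) ∞ N]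
    (j : N → W) (hj : ContMDiff (𝓡 4) (𝓡 5) ∞ j) (hjinj : Injective j)
    (hjimm : ∀ x : N, Injective (mfderiv (𝓡 4) (𝓡 5) j x))
    (hjr : range j = {y : W | ⨅ k ∈ K, G.edist hG y k = ENNReal.ofReal a}) :
    Nonempty (N ≃ₘ⟮𝓡 4, 𝓡 4⟯ Metric.sphere (0 : EuclideanSpace ℝ (Fin 5)) 1) := by
  have _ := he0
  haveI hfact : Fact (finrank ℝ (EuclideanSpace ℝ (Fin 5)) = 4 + 1) :=
    ⟨finrank_euclideanSpace_fin⟩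
  -- (1) the global flow of `X`
  obtain ⟨θ, hθ, h0, hgrp, hcurve, -, hθinj, hdθinj, hinv⟩ :=
    helper_flowToRoundSphere_1 W G hG hcpt X hX hXle
  have hθT : ∀ t : ℝ, ContMDiff (𝓡 5) (𝓡 5) ∞ (fun q : W ↦ θ (t, q)) := fun t ↦
    hθ.comp (contMDiff_const.prodMk contMDiff_id)
  -- the distance to `K` as the distance function of an extended metric structure
  letI := G.riemannianBundle hG
  haveI := G.isContinuousRiemannianBundle hG
  haveI : LocallyCompactSpace W := ChartedSpace.locallyCompactSpace (EuclideanSpace ℝ (Fin 5)) W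
  letI : PseudoEMetricSpace W := .ofRiemannianMetric (𝓡 5) W
  set f : W → ℝ≥0∞ := fun y ↦ ⨅ k ∈ K, G.edist hG y k with hf
  have hfE : ∀ y : W, f y = Metric.infEDist y K := fun _ ↦ rfl
  have hfc : Continuous f := Metric.continuous_infEDist
  have hfj : ∀ x : N, f (j x) = ENNReal.ofReal a := fun x ↦ by
    have h : j x ∈ {y : W | ⨅ k ∈ K, G.edist hG y k = ENNReal.ofReal a} := hjr ▸ mem_range_self x
    exact h
  -- (2) growth of `f` along flow lines started on the level
  have hgrow : ∀ p : W, f p = ENNReal.ofReal a → ∀ t : ℝ, 0 ≤ t →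
      ENNReal.ofReal a + ENNReal.ofReal (δ * t) ≤ f (θ (t, p)) := by
    intro p hp t ht
    have h := hlyap (fun s : ℝ ↦ θ (s, p)) 0 t ht ((hcurve p).isMIntegralCurveOn _)
      (by show ENNReal.ofReal a ≤ f (θ (0, p)); rw [h0, hp])
    have h' : f (θ (0, p)) + ENNReal.ofReal (δ * (t - 0)) ≤ f (θ (t, p)) := h
    rwa [h0, hp, sub_zero] at h'
  -- the bound `D` of `d(o, ·)` on `K`, and `f ≤ |e⁻¹ ·|ₒ + D`
  obtain ⟨k₀, hk₀K, hk₀⟩ := hK.exists_isMaxOn hKne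
    ((G.continuous_edist hG).comp (Continuous.prodMk_right o)).continuousOn
  have hDfin : G.edist hG o k₀ ≠ ⊤ := by
    rw [← e.apply_symm_apply k₀, hedist]
    exact ENNReal.ofReal_ne_top
  set D : ℝ := (G.edist hG o k₀).toReal with hD
  have hD0 : 0 ≤ D := ENNReal.toReal_nonneg
  have hDk : G.edist hG o k₀ = ENNReal.ofReal D := (ENNReal.ofReal_toReal hDfin).symm
  have hfr : ∀ y : W,
      f y ≤ ENNReal.ofReal (Real.sqrt (G.val o (e.symm y) (e.symm y))) + ENNReal.ofReal D := by
    intro y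
    have h1 : G.edist hG o y ≤ ENNReal.ofReal (Real.sqrt (G.val o (e.symm y) (e.symm y))) := by
      have h := hedist (e.symm y)
      rw [e.apply_symm_apply] at h
      exact h.le
    calc f y ≤ G.edist hG y k₀ := iInf₂_le k₀ hk₀K
      _ ≤ G.edist hG y o + G.edist hG o k₀ := G.edist_triangle hG _ _ _
      _ ≤ _ := add_le_add (by rw [G.edist_comm hG]; exact h1) hDk.le
  -- the uniform time `T₁` and the map `F = θ_{T₁} ∘ j` into the radial zone
  set T₁ : ℝ := (R₀ + D + 1) / δ with hT₁
  have hδT : δ * T₁ = R₀ + D + 1 := by rw [hT₁]; field_simp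
  have hT₁0 : 0 ≤ T₁ := div_nonneg (by linarith) hδ.le
  set F : N → W := fun x ↦ θ (T₁, j x) with hFdef
  set w : N → EuclideanSpace ℝ (Fin 5) := fun x ↦ e.symm (F x) with hwdef
  have hew : ∀ x : N, e (w x) = F x := fun x ↦ e.apply_symm_apply _
  have hwR : ∀ x : N, R₀ + 1 ≤ Real.sqrt (G.val o (w x) (w x)) := by
    intro x
    have h1 := (hgrow (j x) (hfj x) T₁ hT₁0).trans (hfr (F x))
    rw [← ENNReal.ofReal_add ha.le (by positivity),
      ← ENNReal.ofReal_add (Real.sqrt_nonneg _) hD0,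
      ENNReal.ofReal_le_ofReal_iff (by positivity)] at h1
    change a + δ * T₁ ≤ Real.sqrt (G.val o (w x) (w x)) + D at h1
    linarith
  have hwR₀ : ∀ x : N, R₀ < Real.sqrt (G.val o (w x) (w x)) := fun x ↦ by linarith [hwR x]
  have hw0 : ∀ x : N, w x ≠ 0 := by
    intro x h
    have h1 := hwR x
    have h2 : G.val o (w x) (w x) = 0 := by
      rw [h]
      exact (by simp : G.val o (0 : TangentSpace (𝓡 5) o) (0 : TangentSpace (𝓡 5) o) = 0)
    rw [h2, Real.sqrt_zero] at h1
    linarith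
  have hFs : ContMDiff (𝓡 4) (𝓡 5) ∞ F := (hθT T₁).comp hj
  have hws : ContMDiff (𝓡 4) 𝓘(ℝ, EuclideanSpace ℝ (Fin 5)) ∞ w := e.symm.contMDiff.comp hFs
  -- `dF = dθ_{T₁} ∘ dj`
  have hdF : ∀ (x : N) (v : TangentSpace (𝓡 4) x), mfderiv (𝓡 4) (𝓡 5) F x v =
      mfderiv (𝓡 5) (𝓡 5) (fun q : W ↦ θ (T₁, q)) (j x) (mfderiv (𝓡 4) (𝓡 5) j x v) := by
    intro x v
    have h := mfderiv_comp x ((hθT T₁).mdifferentiableAt (by simp)) (hj.mdifferentiableAt (by simp))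
    exact congrArg (fun L ↦ L v) h
  -- (3) the radial projection
  set enrm : EuclideanSpace ℝ (Fin 5) → EuclideanSpace ℝ (Fin 5) := fun w ↦ ‖w‖⁻¹ • w with henrm
  have henrm_norm : ∀ w, w ≠ 0 → ‖enrm w‖ = 1 := by
    intro w hw
    simp only [henrm]
    rw [norm_smul, norm_inv, norm_norm, inv_mul_cancel₀ (norm_ne_zero_iff.2 hw)]
  set lam : N → EuclideanSpace ℝ (Fin 5) := fun x ↦ enrm (w x) with hlam
  have hlam_mem : ∀ x, lam x ∈ Metric.sphere (0 : EuclideanSpace ℝ (Fin 5)) 1 := fun x ↦ by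
    rw [mem_sphere_zero_iff_norm]
    exact henrm_norm _ (hw0 x)
  set La : N → Metric.sphere (0 : EuclideanSpace ℝ (Fin 5)) 1 :=
    Set.codRestrict lam _ hlam_mem with hLa
  -- smoothness
  have henrm_d : ContMDiffOn 𝓘(ℝ, EuclideanSpace ℝ (Fin 5)) 𝓘(ℝ, EuclideanSpace ℝ (Fin 5))
      ∞ enrm {w | w ≠ 0} := contDiffOn_normalize.contMDiffOn
  have hlam_s : ContMDiff (𝓡 4) 𝓘(ℝ, EuclideanSpace ℝ (Fin 5)) ∞ lam :=
    henrm_d.comp_contMDiff hws fun x ↦ hw0 x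
  have hLa_s : ContMDiff (𝓡 4) (𝓡 4) ∞ La := hlam_s.codRestrict_sphere hlam_mem
  -- injectivity: two points of `F(N)` on a common ray are joined by a flow line
  have key : ∀ (x₁ x₂ : N) (c : ℝ), 1 ≤ c → w x₂ = c • w x₁ → x₁ = x₂ := by
    intro x₁ x₂ c h1c hc
    set nv : ℝ := Real.sqrt (G.val o (w x₁) (w x₁)) with hnv
    have hnv0 : 0 < nv := hR₀.trans (hwR₀ x₁)
    set ts : ℝ := (c - 1) * nv with hts
    have hts0 : 0 ≤ ts := mul_nonneg (by linarith) hnv0.le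
    -- the ray from `F x₁` reaches `F x₂` at time `ts`
    have hray := helper_flowToRoundSphere_2 W G X o R₀ e hR₀ hX hrad θ h0 hcurve (w x₁) (hwR₀ x₁)
      ts hts0
    rw [hew, show (1 + ts / nv) • w x₁ = w x₂ by
      rw [hc, hts, mul_div_assoc, div_self hnv0.ne', mul_one, add_sub_cancel], hew] at hray
    -- hence `θ (ts, j x₁) = j x₂`
    have hj12 : θ (ts, j x₁) = j x₂ := by
      have h1 : θ (ts + T₁, j x₁) = θ (T₁, j x₂) := by rw [← hgrp]; exact hray
      have h2 := congrArg (fun q ↦ θ (-T₁, q)) h1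
      simp only [hgrp, neg_add_cancel, h0] at h2
      rwa [show -T₁ + (ts + T₁) = ts by ring] at h2
    -- impossible unless `ts = 0`
    have hle := hgrow (j x₁) (hfj x₁) ts hts0
    rw [hj12, hfj, ← add_zero (ENNReal.ofReal a), add_assoc, zero_add,
      ENNReal.add_le_add_iff_left ENNReal.ofReal_ne_top, nonpos_iff_eq_zero,
      ENNReal.ofReal_eq_zero] at hle
    have hts' : ts = 0 := le_antisymm (by nlinarith [mul_nonneg hδ.le hts0]) hts0
    have hc1 : c = 1 := by
      have h : (c - 1) * nv = 0 := hts'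
      rcases mul_eq_zero.1 h with h | h
      · linarith
      · exact absurd h hnv0.ne'
    rw [hc1, one_smul] at hc
    have hF : F x₂ = F x₁ := by rw [← hew, ← hew, hc]
    exact (hjinj (hθinj T₁ hF)).symm
  have hLa_inj : Injective La := by
    intro x₁ x₂ h
    have h' : lam x₁ = lam x₂ := congrArg Subtype.val h
    set c : ℝ := ‖w x₂‖ * ‖w x₁‖⁻¹ with hcdef
    have hc0 : 0 < c :=
      mul_pos (norm_pos_iff.2 (hw0 x₂)) (inv_pos.2 (norm_pos_iff.2 (hw0 x₁)))
    have hc : w x₂ = c • w x₁ := by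
      have h2 : ‖w x₂‖⁻¹ • w x₂ = ‖w x₁‖⁻¹ • w x₁ := h'.symm
      calc w x₂ = ‖w x₂‖ • (‖w x₂‖⁻¹ • w x₂) := by
            rw [smul_smul, mul_inv_cancel₀ (norm_ne_zero_iff.2 (hw0 x₂)), one_smul]
        _ = ‖w x₂‖ • (‖w x₁‖⁻¹ • w x₁) := by rw [h2]
        _ = c • w x₁ := by rw [smul_smul]
    rcases le_total 1 c with h1c | hc1
    · exact key x₁ x₂ c h1c hc
    · refine (key x₂ x₁ c⁻¹ (one_le_inv_iff₀.2 ⟨hc0, hc1⟩) ?_).symm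
      rw [hc, smul_smul, inv_mul_cancel₀ hc0.ne', one_smul]
  -- the differential is injective: the level is transverse to `X`
  have hLa_loc : IsLocalDiffeomorph (𝓡 4) (𝓡 4) ∞ La := by
    intro x
    refine isLocalDiffeomorphAt_of_mfderiv_injective isOpen_univ (mem_univ x) hLa_s.contMDiffOn
      (by exact_mod_cast le_top) rfl ?_
    -- reduce to the `E`-valued map `lam = (↑) ∘ La`
    have hval : ContMDiff (𝓡 4) 𝓘(ℝ, EuclideanSpace ℝ (Fin 5)) ∞
        ((↑) : Metric.sphere (0 : EuclideanSpace ℝ (Fin 5)) 1 → EuclideanSpace ℝ (Fin 5)) :=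
      contMDiff_coe_sphere
    have hcomp : mfderiv (𝓡 4) 𝓘(ℝ, EuclideanSpace ℝ (Fin 5)) lam x =
        (mfderiv (𝓡 4) 𝓘(ℝ, EuclideanSpace ℝ (Fin 5)) Subtype.val (La x)).comp
          (mfderiv (𝓡 4) (𝓡 4) La x) :=
      mfderiv_comp x (hval.mdifferentiableAt (by simp)) (hLa_s.mdifferentiableAt (by simp))
    suffices hlam_inj : Injective (mfderiv (𝓡 4) 𝓘(ℝ, EuclideanSpace ℝ (Fin 5)) lam x) by
      rw [hcomp] at hlam_inj
      exact Injective.of_comp hlam_inj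
    -- differentials of `e` and `e⁻¹`
    have hΨd : MDifferentiableAt (𝓡 5) 𝓘(ℝ, EuclideanSpace ℝ (Fin 5)) e.symm (F x) :=
      e.symm.contMDiff.mdifferentiableAt (by simp)
    have hΦd : MDifferentiableAt 𝓘(ℝ, EuclideanSpace ℝ (Fin 5)) (𝓡 5) e (w x) :=
      e.contMDiff.mdifferentiableAt (by simp)
    have hFd : MDifferentiableAt (𝓡 4) (𝓡 5) F x := hFs.mdifferentiableAt (by simp)
    have hΦΨ : ∀ v, mfderiv 𝓘(ℝ, EuclideanSpace ℝ (Fin 5)) (𝓡 5) e (w x)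
        (mfderiv (𝓡 5) 𝓘(ℝ, EuclideanSpace ℝ (Fin 5)) e.symm (F x) v) = v := by
      intro v
      have hΦd' : MDifferentiableAt 𝓘(ℝ, EuclideanSpace ℝ (Fin 5)) (𝓡 5) e (e.symm (F x)) :=
        e.contMDiff.mdifferentiableAt (by simp)
      have h := mfderiv_comp (F x) hΦd' hΨd
      have hid : (e : EuclideanSpace ℝ (Fin 5) → W) ∘ e.symm = id :=
        funext fun q ↦ e.apply_symm_apply q
      rw [hid, mfderiv_id] at h
      exact (congrArg (fun f ↦ f v) h).symm
    -- kernel computation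
    refine (injective_iff_map_eq_zero _).2 fun ξ hξ ↦ ?_
    have hlam_eq : lam = enrm ∘ w := rfl
    have henrm_md : MDifferentiableAt 𝓘(ℝ, EuclideanSpace ℝ (Fin 5))
        𝓘(ℝ, EuclideanSpace ℝ (Fin 5)) enrm (w x) :=
      (henrm_d.contMDiffAt (isOpen_ne.mem_nhds (hw0 x))).mdifferentiableAt (by simp)
    have hwd : MDifferentiableAt (𝓡 4) 𝓘(ℝ, EuclideanSpace ℝ (Fin 5)) w x :=
      hws.mdifferentiableAt (by simp)
    have hchain := mfderiv_comp x henrm_md hwd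
    rw [← hlam_eq] at hchain
    set η : EuclideanSpace ℝ (Fin 5) :=
      mfderiv (𝓡 4) 𝓘(ℝ, EuclideanSpace ℝ (Fin 5)) w x ξ with hη
    have hξ' : fderiv ℝ enrm (w x) η = 0 := by
      have h1 := congrArg (fun f ↦ f ξ) hchain
      rw [hξ] at h1
      rw [← mfderiv_eq_fderiv]
      exact h1.symm
    obtain ⟨c, hc'⟩ := HadamardConvex.exists_smul_of_fderiv_normalize_eq_zero (hw0 x) hξ'
    -- `η = d(e⁻¹) (dF ξ)`, hence `dF ξ = de_w η = c • de_w w = (c |w|ₒ) • X (F x)`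
    have hηeq : η = mfderiv (𝓡 5) 𝓘(ℝ, EuclideanSpace ℝ (Fin 5)) e.symm (F x)
        (mfderiv (𝓡 4) (𝓡 5) F x ξ) := congrArg (fun f ↦ f ξ) (mfderiv_comp x hΨd hFd)
    have h1 : mfderiv 𝓘(ℝ, EuclideanSpace ℝ (Fin 5)) (𝓡 5) e (w x) η =
        mfderiv (𝓡 4) (𝓡 5) F x ξ := by rw [hηeq]; exact hΦΨ _
    set nv : ℝ := Real.sqrt (G.val o (w x) (w x)) with hnv
    have hnv0 : nv ≠ 0 := (hR₀.trans (hwR₀ x)).ne'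
    have hXe : (X (e (w x)) : EuclideanSpace ℝ (Fin 5)) = X (F x) := by rw [hew]
    have hsm : ∀ (r : ℝ) (v : EuclideanSpace ℝ (Fin 5)),
        mfderiv 𝓘(ℝ, EuclideanSpace ℝ (Fin 5)) (𝓡 5) e (w x) (r • v) =
          r • mfderiv 𝓘(ℝ, EuclideanSpace ℝ (Fin 5)) (𝓡 5) e (w x) v := fun r v ↦
      (mfderiv 𝓘(ℝ, EuclideanSpace ℝ (Fin 5)) (𝓡 5) e (w x)).map_smul r v
    -- everything below lives in `T_{e (w x)} W`
    have h3 : mfderiv 𝓘(ℝ, EuclideanSpace ℝ (Fin 5)) (𝓡 5) e (w x) (w x) = nv • X (e (w x)) := by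
      rw [hrad (w x) (hwR₀ x).le, ← hnv, hsm, smul_smul, mul_inv_cancel₀ hnv0, one_smul]
    have hdFξ : mfderiv 𝓘(ℝ, EuclideanSpace ℝ (Fin 5)) (𝓡 5) e (w x) η =
        (c * nv) • X (e (w x)) := by
      rw [hc', hsm, h3, smul_smul]
    by_cases hc0 : c = 0
    · rw [hc0, zero_mul, zero_smul] at hdFξ
      have hA : mfderiv (𝓡 5) (𝓡 5) (fun q : W ↦ θ (T₁, q)) (j x) (mfderiv (𝓡 4) (𝓡 5) j x ξ) =
          0 := (hdF x ξ).symm.trans (h1.symm.trans hdFξ)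
      have h2 : mfderiv (𝓡 4) (𝓡 5) j x ξ = 0 :=
        hdθinj T₁ (j x) (hA.trans (map_zero _).symm)
      exact hjimm x (h2.trans (map_zero _).symm)
    · exfalso
      have hcn : c * nv ≠ 0 := mul_ne_zero hc0 hnv0
      set r : ℝ := (c * nv)⁻¹ with hr
      have hXF : X (e (w x)) = r • mfderiv 𝓘(ℝ, EuclideanSpace ℝ (Fin 5)) (𝓡 5) e (w x) η := by
        rw [hdFξ, smul_smul, hr, inv_mul_cancel₀ hcn, one_smul]
      have hFr : mfderiv (𝓡 4) (𝓡 5) F x (r • ξ) = r • mfderiv (𝓡 4) (𝓡 5) F x ξ :=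
        (mfderiv (𝓡 4) (𝓡 5) F x).map_smul r ξ
      have hchain : mfderiv (𝓡 5) (𝓡 5) (fun q : W ↦ θ (T₁, q)) (j x) (X (j x)) =
          mfderiv (𝓡 5) (𝓡 5) (fun q : W ↦ θ (T₁, q)) (j x) (mfderiv (𝓡 4) (𝓡 5) j x (r • ξ)) :=
        (hinv T₁ (j x)).trans <| hXe.symm.trans <| hXF.trans <|
          (congrArg (fun v ↦ r • v) h1).trans <| hFr.symm.trans (hdF x (r • ξ))
      have hXj : X (j x) = mfderiv (𝓡 4) (𝓡 5) j x (r • ξ) := hdθinj T₁ (j x) hchain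
      exact helper_flowToRoundSphere_3 W G hG K a X δ hδ hlyap θ hθ h0 hcurve N j hj hfj x
        ⟨_, hXj.symm⟩
  -- surjectivity: `N ≠ ∅` and the image is open and closed in the connected sphere
  have hNne : Nonempty N := by
    obtain ⟨k₁, hk₁⟩ := hKne
    have hf0 : f k₁ = 0 := Metric.infEDist_zero_of_mem hk₁
    -- a far point
    obtain ⟨u, hu0⟩ := exists_ne (0 : EuclideanSpace ℝ (Fin 5))
    set qu : ℝ := Real.sqrt (G.val o u u) with hqu
    have hqu0 : 0 < qu := Real.sqrt_pos.2 (hG o u hu0)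
    set v : EuclideanSpace ℝ (Fin 5) := ((a + D) / qu) • u with hv
    have hvn : Real.sqrt (G.val o v v) = a + D := by
      have h : Real.sqrt (G.val o v v) = (a + D) / qu * Real.sqrt (G.val o u u) :=
        FlowToRoundSphere.sqrt_val_smul (G.val o) u (by positivity)
      rw [h, ← hqu, div_mul_cancel₀ _ hqu0.ne']
    have hfar : ENNReal.ofReal a ≤ f (e v) := by
      refine le_iInf₂ fun k hk ↦ ?_
      have h1 : G.edist hG o (e v) ≤ G.edist hG o k + G.edist hG k (e v) := G.edist_triangle hG _ _ _
      rw [hedist, hvn, ENNReal.ofReal_add ha.le hD0, G.edist_comm hG k, add_comm] at h1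
      have h2 : ENNReal.ofReal D + ENNReal.ofReal a ≤ ENNReal.ofReal D + G.edist hG (e v) k :=
        h1.trans (add_le_add ((hk₀ hk).trans hDk.le) le_rfl)
      exact (ENNReal.add_le_add_iff_left ENNReal.ofReal_ne_top).1 h2
    -- intermediate value theorem on the connected `W = e(ℝ⁵)`
    have hWpc : IsPreconnected (univ : Set W) := by
      rw [← e.surjective.range_eq, ← image_univ]
      exact isPreconnected_univ.image _ e.continuous.continuousOn
    obtain ⟨y, -, hy⟩ := hWpc.intermediate_value (mem_univ k₁) (mem_univ (e v)) hfc.continuousOn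
      ⟨by rw [hf0]; exact zero_le, hfar⟩
    have hyr : y ∈ range j := by rw [hjr]; exact hy
    obtain ⟨x, -⟩ := hyr
    exact ⟨x⟩
  have hLa_surj : Surjective La := by
    have h1 : 1 < Module.rank ℝ (EuclideanSpace ℝ (Fin 5)) := by
      rw [← Module.finrank_eq_rank, finrank_euclideanSpace_fin]
      norm_num
    haveI : PreconnectedSpace (Metric.sphere (0 : EuclideanSpace ℝ (Fin 5)) 1) :=
      isPreconnected_iff_preconnectedSpace.1 (isPreconnected_sphere h1 0 1)
    have huniv : range La = univ :=
      IsClopen.eq_univ ⟨(isCompact_range hLa_s.continuous).isClosed, hLa_loc.isOpen_range⟩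
        (range_nonempty La)
    intro y
    have hy : y ∈ range La := huniv ▸ mem_univ y
    exact hy
  exact ⟨hLa_loc.diffeomorphOfBijective ⟨hLa_inj, hLa_surj⟩⟩

end Summit.SmoothPoincare4.SmoothPoincare4.Cruxes.C0AhRecognition.CoreDistanceMorse

end
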